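import Summits.MatrixMultiplication.OmegaCensus.SmallFormats.MatMul227GF3FootprintBlockForm
import Summits.MatrixMultiplication.OmegaCensus.SmallFormats.KroneckerMain
import Summits.MatrixMultiplication.OmegaCensus.SmallFormats.KroneckerFlatten

/-!
# ω-census family (a): `KroneckerBlockForm97` PROVED — `24 ≤ R_𝔽₃(⟨2,2,7⟩) ≤ 25` is an unconditional tree theorem

Cell `pub-omega` (unit `pub-omega-tensor-g33`), topic `Summits/MatrixMultiplication/OmegaCensus` (sub-folder `SmallFormats`).
Framing (verbatim): lottery ticket; floor = certified bounds/negative ranges. HONEST FRAMING: this file DISCHARGES the one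
hypothesis (`Enum723.KroneckerBlockForm97`, tensor g32 p642513) of the (7,23) footprint-kill chain: the `(9,7)` instance over
`𝔽₃` of the Weierstraß–Kronecker block form, subspace version, is derived from the general theorem
`Kronecker.kronecker_blockDecomposition` (this lane, files `Kronecker*`). Consequently `24 ≤ R_𝔽₃(⟨2,2,7⟩)`
(`twentyfour_le_tensorRank_227_gf3`) and `R_𝔽₃(⟨2,2,7⟩) ∈ [24, 25]` hold with NO hypothesis and standard axioms. The value is a
theorem about the rank of one small matrix-multiplication tensor over one finite field; it says nothing about `ω`.

Derivation: enlarge `WW` to dimension `9`; view it as the Kronecker module `W ↦ (W 0, W 1)`; block-decompose; the row vectors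
being independent excludes `L₀ᵀ` blocks and the no-common-kernel hypothesis excludes `L₀` blocks (dual-basis functional); sort
the blocks (`Tuple.sort` by `PBlock.key`) so the list is one of the 2 255 `blockListsW` (`KroneckerEnum97`); the column basis gives
`Q⁻¹`; row `rowOff j + r` of the block pencil is `(e j r) Q` (offset lemma `bsEntry_rowOff`, digit bridge `decB_blockRowsCode`).
-/

namespace Summit.MatrixMultiplication.OmegaCensus.SmallFormats

open Module Submodule Matrix Kronecker KroneckerFlat Literature.Computability.AlgebraicComplexity

/-! ## Enlarging a subspace to a prescribed dimension -/

/-- A subspace of dimension `≤ d ≤ finrank M` lies in a subspace of dimension exactly `d`. -/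
theorem exists_le_finrank_eq {k M : Type*} [Field k] [AddCommGroup M] [Module k M] [FiniteDimensional k M]
    (S : Submodule k M) (d : ℕ) (hS : finrank k S ≤ d) (hd : d ≤ finrank k M) :
    ∃ S' : Submodule k M, S ≤ S' ∧ finrank k S' = d := by
  obtain ⟨n, hn⟩ : ∃ n, finrank k S + n = d := ⟨d - finrank k S, by omega⟩
  induction n generalizing S with
  | zero => exact ⟨S, le_rfl, by simpa using hn⟩
  | succ n ih =>
      have hne : S ≠ ⊤ := by
        intro h; rw [h, finrank_top] at hn; omega
      obtain ⟨v, hv⟩ : ∃ v, v ∉ S := by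
        by_contra h; push Not at h; exact hne (Submodule.eq_top_iff'.mpr h)
      have hv0 : v ≠ 0 := fun h => hv (h ▸ S.zero_mem)
      have hdisj : Disjoint S (k ∙ v) := (Submodule.disjoint_span_singleton' hv0).mpr hv
      have hdim : finrank k ↥(S ⊔ k ∙ v) = finrank k S + 1 := by
        have := Submodule.finrank_sup_add_finrank_inf_eq S (k ∙ v)
        rw [disjoint_iff.mp hdisj, finrank_bot, finrank_span_singleton hv0] at this
        omega
      obtain ⟨S', hS', hd'⟩ := ih (S ⊔ k ∙ v) (by omega) (by omega)
      exact ⟨S', le_trans le_sup_left hS', hd'⟩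

/-! ## The two row maps -/

/-- Row `r` of a `2 × 7` matrix, as a linear map. -/
def rowLin (r : Fin 2) : Matrix (Fin 2) (Fin 7) (ZMod 3) →ₗ[ZMod 3] (Fin 7 → ZMod 3) where
  toFun W := W r
  map_add' _ _ := rfl
  map_smul' _ _ := rfl

/-- `rowLin r W = W r`. -/
@[simp] theorem rowLin_apply (r : Fin 2) (W : Matrix (Fin 2) (Fin 7) (ZMod 3)) : rowLin r W = W r := rfl

/-- A row vector times `Q` is the corresponding row of the matrix product. -/
theorem vecMul_eq_mul_apply (W : Matrix (Fin 2) (Fin 7) (ZMod 3)) (Q : Matrix (Fin 7) (Fin 7) (ZMod 3)) (s : Fin 2) :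
    W s ᵥ* Q = (W * Q) s := by
  funext m; simp [Matrix.vecMul, Matrix.mul_apply, dotProduct]

/-- Row `m` of `P` times `Q` is row `m` of `P * Q`. -/
theorem row_vecMul (P Q : Matrix (Fin 7) (Fin 7) (ZMod 3)) (m : Fin 7) : P m ᵥ* Q = (P * Q) m := by
  funext t; simp [Matrix.vecMul, Matrix.mul_apply, dotProduct]

/-- A vector is the combination of the standard vectors with its entries. -/
theorem eq_sum_smul_single (v : Fin 7 → ZMod 3) : v = ∑ m, v m • Pi.single m (1 : ZMod 3) := by
  funext t
  simp [Finset.sum_apply, Pi.single_apply]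

/-- A one-term sum over a range: `Σ_{c<D} A c * [m = o + c]`. -/
theorem sum_mul_indicator (D o m : ℕ) (A : ℕ → ZMod 3) :
    ∑ c ∈ Finset.range D, A c * (if m = o + c then 1 else 0) = if o ≤ m ∧ m < o + D then A (m - o) else 0 := by
  by_cases h : o ≤ m ∧ m < o + D
  · rw [if_pos h, Finset.sum_eq_single (m - o)]
    · rw [if_pos (by omega), mul_one]
    · intro c _ hc; rw [if_neg (by omega), mul_zero]
    · intro hc; exact absurd (Finset.mem_range.mpr (by omega)) hc
  · rw [if_neg h]
    exact Finset.sum_eq_zero (fun c hc => by rw [if_neg (by have := Finset.mem_range.mp hc; omega), mul_zero])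

/-! ## The theorem -/

set_option maxHeartbeats 800000 in
/-- **`KroneckerBlockForm97` holds**: the `(9,7)` Weierstraß–Kronecker block form over `𝔽₃`, subspace version. -/
theorem kroneckerBlockForm97 : Enum723.KroneckerBlockForm97 := by
  classical
  intro WW hdim hsupp
  -- 1. enlarge to dimension 9
  have h14 : finrank (ZMod 3) (Matrix (Fin 2) (Fin 7) (ZMod 3)) = 14 := by
    rw [Module.finrank_matrix]; simp
  obtain ⟨WW', hle, hdim'⟩ := exists_le_finrank_eq WW 9 hdim (by rw [h14]; norm_num)
  -- 2. the Kronecker module of WW'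
  let a : WW' →ₗ[ZMod 3] (Fin 7 → ZMod 3) := (rowLin 0).comp WW'.subtype
  let b : WW' →ₗ[ZMod 3] (Fin 7 → ZMod 3) := (rowLin 1).comp WW'.subtype
  have ha : ∀ u : WW', a u = (u : Matrix (Fin 2) (Fin 7) (ZMod 3)) 0 := fun u => rfl
  have hb : ∀ u : WW', b u = (u : Matrix (Fin 2) (Fin 7) (ZMod 3)) 1 := fun u => rfl
  obtain ⟨n, blk, e, f, D, hprop⟩ := kronecker_blockDecomposition a b
  -- 3. the row and column families are bases
  let F : (Σ i : Fin n, Fin (blk i).cols) → (Fin 7 → ZMod 3) := fun p => f p.1 p.2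
  have hFspan : ⊤ ≤ span (ZMod 3) (Set.range F) := by
    rintro v -
    obtain ⟨g, hg⟩ := D.span_f v
    rw [hg]
    exact Submodule.sum_mem _ fun i _ => Submodule.sum_mem _ fun c hc =>
      Submodule.smul_mem _ _ (subset_span ⟨⟨i, ⟨c, Finset.mem_range.mp hc⟩⟩, rfl⟩)
  have h7 : finrank (ZMod 3) (Fin 7 → ZMod 3) = 7 := Module.finrank_fin_fun (ZMod 3)
  have hFcard : Fintype.card (Σ i : Fin n, Fin (blk i).cols) = finrank (ZMod 3) (Fin 7 → ZMod 3) := by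
    rw [Fintype.card_sigma, ← D.cols_eq]; simp
  have hFind : LinearIndependent (ZMod 3) F := linearIndependent_of_top_le_span_of_card_eq_finrank hFspan hFcard
  let E : (Σ i : Fin n, Fin (blk i).rows) → WW' := fun p => e p.1 p.2
  have hEspan : ⊤ ≤ span (ZMod 3) (Set.range E) := by
    rintro u -
    obtain ⟨g, hg⟩ := D.span_e u
    rw [hg]
    exact Submodule.sum_mem _ fun i _ => Submodule.sum_mem _ fun r hr =>
      Submodule.smul_mem _ _ (subset_span ⟨⟨i, ⟨r, Finset.mem_range.mp hr⟩⟩, rfl⟩)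
  have hEcard : Fintype.card (Σ i : Fin n, Fin (blk i).rows) = finrank (ZMod 3) WW' := by
    rw [Fintype.card_sigma, ← D.rows_eq]; simp
  have hEind : LinearIndependent (ZMod 3) E := linearIndependent_of_top_le_span_of_card_eq_finrank hEspan hEcard
  -- 4a. no `LT 0` block: its row vector would vanish
  have hLT : ∀ i, blk i ≠ .LT 0 := by
    intro i hi
    have hr : 0 < (blk i).rows := by rw [hi]; decide
    have hc : (blk i).cols = 0 := by rw [hi]; rfl
    have h0 : e i 0 = 0 := by
      apply Subtype.ext
      ext s m
      have ha0 := D.rel_a i 0 hr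
      have hb0 := D.rel_b i 0 hr
      rw [hc, Finset.range_zero, Finset.sum_empty] at ha0 hb0
      rcases (by omega : (s : ℕ) = 0 ∨ (s : ℕ) = 1) with hs | hs
      · rw [show s = 0 from Fin.ext hs]; exact (congrFun ha0 m).trans rfl
      · rw [show s = 1 from Fin.ext hs]; exact (congrFun hb0 m).trans rfl
    exact hEind.ne_zero ⟨i, ⟨0, hr⟩⟩ h0
  -- 4b. no `L 0` block: its column would be a common kernel vector
  have hL : ∀ i, blk i ≠ .L 0 := by
    intro i hi
    have hc : 0 < (blk i).cols := by rw [hi]; decide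
    have hr : (blk i).rows = 0 := by rw [hi]; rfl
    let bF := Basis.mk hFind hFspan
    let p₀ : (Σ i : Fin n, Fin (blk i).cols) := ⟨i, ⟨0, hc⟩⟩
    let φ := bF.coord p₀
    have hφF : ∀ p, p ≠ p₀ → φ (F p) = 0 := fun p hp => Basis.mk_coord_apply_ne hp
    have hφf : ∀ j c, c < (blk j).cols → j ≠ i → φ (f j c) = 0 := fun j c hjc hji =>
      hφF ⟨j, ⟨c, hjc⟩⟩ (fun h => hji (congrArg Sigma.fst h))
    -- φ kills both rows of every member of WW'
    have hφa : ∀ u : WW', φ (a u) = 0 ∧ φ (b u) = 0 := by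
      intro u
      obtain ⟨g, hg⟩ := D.span_e u
      have key : ∀ (G : KBlock (ZMod 3) → ℕ → ℕ → ZMod 3) (h : WW' →ₗ[ZMod 3] (Fin 7 → ZMod 3)),
          (∀ j, ∀ r < (blk j).rows, h (e j r) = ∑ c ∈ Finset.range (blk j).cols, G (blk j) r c • f j c) → φ (h u) = 0 := by
        intro G h hrel
        rw [hg, map_sum, map_sum]
        refine Finset.sum_eq_zero fun j _ => ?_
        rw [map_sum, map_sum]
        refine Finset.sum_eq_zero fun r hr' => ?_
        rw [map_smul, map_smul, hrel j r (Finset.mem_range.mp hr'), map_sum, smul_eq_zero]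
        refine Or.inr (Finset.sum_eq_zero fun c hc' => ?_)
        rw [map_smul, smul_eq_zero]
        by_cases hji : j = i
        · subst hji; rw [hr] at hr'; exact absurd hr' (by simp)
        · exact Or.inr (hφf j c (Finset.mem_range.mp hc') hji)
      exact ⟨key _ a D.rel_a, key _ b D.rel_b⟩
    let x : Fin 7 → ZMod 3 := fun m => φ (Pi.single m 1)
    have hφv : ∀ v : Fin 7 → ZMod 3, φ v = v ⬝ᵥ x := by
      intro v
      conv_lhs => rw [eq_sum_smul_single v]
      rw [map_sum]
      simp only [map_smul, smul_eq_mul, dotProduct, x]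
    have hx0 : x ≠ 0 := by
      intro hx
      have h1 : φ (F p₀) = 1 := Basis.mk_coord_apply_eq p₀
      rw [hφv] at h1
      rw [hx, dotProduct_zero] at h1
      exact zero_ne_one h1
    obtain ⟨W, hW, hWx⟩ := hsupp x hx0
    apply hWx
    have hu := hφa ⟨W, hle hW⟩
    rw [ha, hb, hφv, hφv] at hu
    funext s
    rcases (by omega : (s : ℕ) = 0 ∨ (s : ℕ) = 1) with hs | hs
    · rw [show s = 0 from Fin.ext hs]; exact hu.1
    · rw [show s = 1 from Fin.ext hs]; exact hu.2
  -- 5. sort the blocks and convert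
  let σ := Tuple.sort (fun i => (toP (blk i)).key)
  have D' := D.reindex σ
  let l : List PBlock := List.ofFn (fun j => toP (blk (σ j)))
  have hl_len : l.length = n := by simp [l]
  have hl_get : ∀ j : Fin n, l[(j : ℕ)]'(by rw [hl_len]; exact j.2) = toP (blk (σ j)) := fun j => by
    simp [l, List.getElem_ofFn]
  have hadm : ∀ B ∈ l, B.adm = true := by
    intro B hB
    obtain ⟨j, rfl⟩ := List.mem_ofFn.mp hB
    exact adm_toP _ (hprop _) (hL _) (hLT _)
  have hsorted : l.Pairwise (fun B B' => B.key ≤ B'.key) := pairwise_key_ofFn_sort (fun i => toP (blk i))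
  have hrows : totRows l = 9 := by
    have := D'.rows_eq
    rw [hdim'] at this
    simp only [l, totRows, List.map_ofFn, List.sum_ofFn, Function.comp_def, rows_toP] at this ⊢
    exact this
  have hcols : totCols l = 7 := by
    have := D'.cols_eq
    rw [h7] at this
    simp only [l, totCols, List.map_ofFn, List.sum_ofFn, Function.comp_def, cols_toP] at this ⊢
    exact this
  have hmem : l ∈ blockListsW := KroneckerEnum.mem_blockListsW_of_sorted l hadm hsorted hrows hcols
  -- 6. the column basis in flat order and Q
  let fN : ℕ → ℕ → (Fin 7 → ZMod 3) := fun j c => if h : j < n then f (σ ⟨j, h⟩) c else 0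
  let Fcol : Fin 7 → (Fin 7 → ZMod 3) := fun m => fN (colBlock l m).1 (colBlock l m).2
  have hFcol : ∀ (j : Fin n) (c : ℕ), c < (blk (σ j)).cols → ∀ (h : colOff l j + c < 7),
      Fcol ⟨colOff l j + c, h⟩ = f (σ j) c := by
    intro j c hc h
    have hj : (j : ℕ) < l.length := by rw [hl_len]; exact j.2
    have := colBlock_colOff l j hj c (by rw [hl_get j, cols_toP]; exact hc)
    simp only [Fcol, fN, this, j.2, dif_pos, Fin.eta]
  have hcolOff_lt : ∀ (j : Fin n) (c : ℕ), c < (blk (σ j)).cols → colOff l j + c < 7 := by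
    intro j c hc
    have hj : (j : ℕ) < l.length := by rw [hl_len]; exact j.2
    have := colOff_add_cols_le l j hj
    rw [hl_get j, cols_toP, hcols] at this
    omega
  have hFcolInd : LinearIndependent (ZMod 3) Fcol := by
    -- Fcol = F ∘ ι with ι injective
    have hspec : ∀ m : Fin 7, (colBlock l m).1 < n ∧ ∃ h : (colBlock l m).1 < n,
        (colBlock l m).2 < (blk (σ ⟨(colBlock l m).1, h⟩)).cols ∧ colOff l (colBlock l m).1 + (colBlock l m).2 = m := by
      intro m
      obtain ⟨h1, h1', h2, h3⟩ := colBlock_spec l m (by rw [hcols]; exact m.2)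
      rw [hl_len] at h1
      refine ⟨h1, h1, ?_, h3⟩
      have hg := hl_get ⟨_, h1⟩
      rw [hg, cols_toP] at h2
      exact h2
    let ι : Fin 7 → (Σ i : Fin n, Fin (blk i).cols) := fun m =>
      ⟨σ ⟨(colBlock l m).1, (hspec m).1⟩, ⟨(colBlock l m).2, (hspec m).2.2.1⟩⟩
    have hFι : F ∘ ι = Fcol := by
      funext m
      simp only [Function.comp, F, ι, Fcol, fN, (hspec m).1, dif_pos]
    have hι : Function.Injective ι := by
      intro m m' h
      have h1 := congrArg Sigma.fst h
      have h2 := congrArg (fun q : (Σ i : Fin n, Fin (blk i).cols) => (q.2 : ℕ)) h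
      simp only [ι] at h1 h2
      have hj : (colBlock l m).1 = (colBlock l m').1 := by
        have := σ.injective h1; simpa using this
      apply Fin.ext
      rw [← (hspec m).2.2.2, ← (hspec m').2.2.2, hj, h2]
    rw [← hFι]
    exact hFind.comp ι hι
  let P : Matrix (Fin 7) (Fin 7) (ZMod 3) := Matrix.of fun m t => Fcol m t
  have hProw : ∀ m, P m = Fcol m := fun m => rfl
  have hPunit : IsUnit P := Matrix.linearIndependent_rows_iff_isUnit.mp (by exact hFcolInd)
  have hPQ : P * P⁻¹ = 1 := Matrix.mul_nonsing_inv P ((Matrix.isUnit_iff_isUnit_det P).mp hPunit)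
  have hvec : ∀ m, Fcol m ᵥ* P⁻¹ = Pi.single m 1 := by
    intro m
    rw [← hProw, row_vecMul, hPQ]
    funext t
    rw [Matrix.one_apply, Pi.single_apply]
    by_cases h : m = t
    · rw [if_pos h, if_pos h.symm]
    · rw [if_neg h, if_neg (Ne.symm h)]
  -- 7. rows of the block pencil = (e j r) Q
  have hrowOff_lt : ∀ (j : Fin n) (r : ℕ), r < (blk (σ j)).rows → rowOff l j + r < 9 := by
    intro j r hr
    have hj : (j : ℕ) < l.length := by rw [hl_len]; exact j.2
    have := rowOff_add_rows_le l j hj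
    rw [hl_get j, rows_toP, hrows] at this
    omega
  have hrow : ∀ (j : Fin n) (r : ℕ) (hr : r < (blk (σ j)).rows),
      ((e (σ j) r : WW') : Matrix (Fin 2) (Fin 7) (ZMod 3)) * P⁻¹ =
        decB (blockRowsCode l) ⟨rowOff l j + r, hrowOff_lt j r hr⟩ := by
    intro j r hr
    have hj : (j : ℕ) < l.length := by rw [hl_len]; exact j.2
    have hrP : r < (l[(j : ℕ)]).rows := by rw [hl_get j, rows_toP]; exact hr
    -- row s of (e Q) as a combination of standard vectors
    have hcomb : ∀ (G : KBlock (ZMod 3) → ℕ → ℕ → ZMod 3) (v : Fin 7 → ZMod 3),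
        v = ∑ c ∈ Finset.range (blk (σ j)).cols, G (blk (σ j)) r c • f (σ j) c →
        ∀ m : Fin 7, (v ᵥ* P⁻¹) m =
          if colOff l j ≤ m ∧ (m : ℕ) < colOff l j + (blk (σ j)).cols then G (blk (σ j)) r (m - colOff l j) else 0 := by
      intro G v hv m
      rw [hv, ← Matrix.vecMulLinear_apply, map_sum]
      simp only [map_smul, Matrix.vecMulLinear_apply, Finset.sum_apply, Pi.smul_apply, smul_eq_mul]
      rw [← sum_mul_indicator]
      refine Finset.sum_congr rfl fun c hc => ?_
      have hc' := Finset.mem_range.mp hc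
      rw [← hFcol j c hc' (hcolOff_lt j c hc'), hvec, Pi.single_apply]
      congr 1
      simp [Fin.ext_iff]
    ext s m
    have hmul : (((e (σ j) r : WW') : Matrix (Fin 2) (Fin 7) (ZMod 3)) * P⁻¹) s m =
        ((((e (σ j) r : WW') : Matrix (Fin 2) (Fin 7) (ZMod 3)) s) ᵥ* P⁻¹) m := by rw [vecMul_eq_mul_apply]
    rw [hmul, decB_blockRowsCode l ⟨rowOff l j + r, _⟩ s m]
    rcases (by omega : (s : ℕ) = 0 ∨ (s : ℕ) = 1) with hs | hs
    · have hs0 : s = 0 := Fin.ext hs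
      subst hs0
      have hra : a (e (σ j) r) = ∑ c ∈ Finset.range (blk (σ j)).cols, (blk (σ j)).A r c • f (σ j) c :=
        D'.rel_a j r hr
      rw [show ((e (σ j) r : WW') : Matrix (Fin 2) (Fin 7) (ZMod 3)) 0 = a (e (σ j) r) from rfl,
        hcomb KBlock.A _ hra m, bsEntry_rowOff PBlock.a l j hj r hrP m, hl_get j, cols_toP]
      simp only [Fin.val_zero, if_true]
      split_ifs <;> simp [cast_a_toP]
    · have hs1 : s = 1 := Fin.ext hs
      subst hs1
      have hrb : b (e (σ j) r) = ∑ c ∈ Finset.range (blk (σ j)).cols, (blk (σ j)).B r c • f (σ j) c :=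
        D'.rel_b j r hr
      rw [show ((e (σ j) r : WW') : Matrix (Fin 2) (Fin 7) (ZMod 3)) 1 = b (e (σ j) r) from rfl,
        hcomb KBlock.B _ hrb m, bsEntry_rowOff PBlock.b l j hj r hrP m, hl_get j, cols_toP]
      simp only [Fin.val_one, one_ne_zero, if_false]
      split_ifs <;> simp [cast_b_toP]
  -- 8. assemble
  refine ⟨l, hmem, P⁻¹, P, hPQ, ?_⟩
  rintro _ ⟨W, hW, rfl⟩
  rw [mulRightLin_apply]
  obtain ⟨g, hg⟩ := D'.span_e ⟨W, hle hW⟩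
  have hW' : W = ∑ j, ∑ r ∈ Finset.range (blk (σ j)).rows, g j r • ((e (σ j) r : WW') : Matrix (Fin 2) (Fin 7) (ZMod 3)) := by
    have := congrArg Subtype.val hg
    simpa [Submodule.coe_sum] using this
  rw [hW', Matrix.sum_mul]
  refine Submodule.sum_mem _ fun j _ => ?_
  rw [Matrix.sum_mul]
  refine Submodule.sum_mem _ fun r hr => ?_
  rw [Matrix.smul_mul]
  refine Submodule.smul_mem _ _ ?_
  rw [hrow j r (Finset.mem_range.mp hr)]
  exact subset_span ⟨_, rfl⟩

/-- **`24 ≤ R_𝔽₃(⟨2,2,7⟩)`** — unconditional. -/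
theorem twentyfour_le_tensorRank_227_gf3 : 24 ≤ tensorRank (matMulTensor (ZMod 3) 2 2 7) :=
  Enum723.twentyfour_le_tensorRank_227_gf3_of_blockForm kroneckerBlockForm97

/-- **`R_𝔽₃(⟨2,2,7⟩) ∈ [24, 25]`** — unconditional. -/
theorem tensorRank_227_gf3_mem : tensorRank (matMulTensor (ZMod 3) 2 2 7) ∈ Set.Icc 24 25 :=
  Enum723.tensorRank_227_gf3_mem_of_blockForm kroneckerBlockForm97

/-- **The catalog `catW2255` is complete** — unconditional. -/
theorem catalogCompleteK_catW2255 : CatalogCompleteK 7 9 Enum723.catW2255 :=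
  Enum723.catalogCompleteK_catW2255_of_blockForm kroneckerBlockForm97

end Summit.MatrixMultiplication.OmegaCensus.SmallFormats
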